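import Summits.QuantumFields.BalabanUV.T4Continuum.Support.B13AvgCorrPlaquette

/-!
# B13AvgCorrPlaquetteSecond — row NE5, J-avg-reg SECOND ORDER (owner R60 l.24769 ∕ INTENT g39-d l.24783: σ-leaf «σ-L2 second-order plaquette letter
# from β″»; T4-DAG Q49 (b); memo `t4/T4-EST-NE5-JAVG-SECOND.md` §3 (S5) step P1-a): THE PLAQUETTE OF A UNITARY (α, β, β₂)-REGULAR LEVEL IS
# `(2β₂ + 4αβ)∕ℓ³ + 2β(2β + 2α²)∕ℓ⁴`-LIPSCHITZ ACROSS ONE LATTICE STEP — the letter a first-variation Stokes (σ-L1) consumes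

Cell `pub-balaban`, NE5 formalisation swarm, unit `b2b-balaban-t4-ne5-formalise-leaf-08` (gen 19).  Summits-side NEW WORK under the LEAN PLACEMENT RULE:
[folklore] C⋆-norm algebra of unitary matrices (§1) read in the tower currency of rows NE2 ∕ B5 (§2), κ-L2 `B13AvgCorrPlaquette` BY NAME; 0 `def`,
no `Prop`-valued fact, nothing printed asserted, no citation tag.  Item σ-L2 of T4-DAG Q52 (2) (dagwriter l.24813, «UNCLAIMED ∕ swarm-claimable»);
CLAIM + INTENT `HOME/CLAIMS.log` l.24876.
HONEST FRAMING: rung (B)+1 of the FINITE-VOLUME T⁴ programme — NOT infinite volume, NOT a mass gap, NOT the Clay problem, NOT a proof of NE5 (NOT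
PRINTED); an elementary estimate on OUR abstract towers under a DISPLAYED second-difference letter ((3.36)-SHAPE, owner R60 (2)); nothing of
[Balaban1985Averaging] ∕ [Balaban1985BackgroundPropagators] instantiated.  HONEST DEPENDENCY (cell, verbatim): continuum YM on T⁴ ⇐ BetaPertH ∧ nine
spine estimates (0/9 proved); BetaPertH ⇐ (D1) ∧ (D4) ∧ CAP+tail; G-an2-4 gates asym, D1 and NE2/3/4.

WHY.  κ-L2 bounds the plaquette deviation `‖a·b·c⋆·d⋆ − 1‖ ≤ (2β + 2α²)∕ℓ²` from the (3.35)-shape letters.  The second-order programme ((ℓ2)(ℓ4), R60)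
needs the VARIATION of the correction factors across blocks (letter ρ₁∕κ₁ at scale `ℓ⁻³`), which a first-variation non-abelian Stokes reduces to
the variation of the finest plaquettes across one lattice step; first-order letters give only `O(β∕ℓ²)` for that (one order short, R60 (3)).  With the
second-difference letter `‖ℓ·(R(τ_ν τ_ρ i) − R(τ_ν i) − R(τ_ρ i) + R(i))‖ ≤ β₂∕ℓ²` the cancellation `a·b − d·c = (a − c) + (b − d) + (a−1)(b−1) − (d−1)(c−1)`
(curl + quadratic) gives the extra `ℓ⁻¹`:
* §1 `plaq_sub_one_eq_mul` (`a b c⋆ d⋆ − 1 = (ab − dc)·(c⋆d⋆)`, `c, d` unitary), `ab_sub_dc_eq`, `norm_prodSubOne_sub_le`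
  (`‖(a′−1)(b′−1) − (a−1)(b−1)‖ ≤ ‖a′−a‖‖b′−1‖ + ‖a−1‖‖b′−b‖`), `norm_star_mul_star_sub_le`, and the generic END `norm_plaq_sub_plaq_le`:
  `‖a′b′c′⋆d′⋆ − abc⋆d⋆‖ ≤ ‖X′ − X‖ + ‖X‖·(‖c′ − c‖ + ‖d′ − d‖)`, `X = ab − dc`;
* §2 tower END `norm_plaquette_tau_sub_le_of_reg2`: under `RegularTransporters L M R α β`, unitarity and the DISPLAYED second-difference letter `h2`,
  `‖plaq(τ_ρ i) − plaq(i)‖ ≤ (2β₂ + 4αβ)∕(lev L k)³ + 2β(2β + 2α²)∕(lev L k)⁴`.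
0 sorry; axioms ⊆ {propext, Classical.choice, Quot.sound}.
-/

noncomputable section

open scoped Matrix Matrix.Norms.L2Operator

namespace Summit.QuantumFields.BalabanUV.T4Continuum.B13AvgCorrPlaquetteSecond

open Summit.QuantumFields.BalabanUV.T4Continuum.B13AvgCorrPlaquette (norm_mul_unitary norm_sub_one_le_of_reg norm_tau_sub_le_of_reg)

variable {o : Type*} [Fintype o] [DecidableEq o]

/-! ## §1 Unitary algebra: the plaquette as `(ab − dc)·(c⋆d⋆)` and its variation -/

/-- [folklore] for unitary `c, d`: `a·b·c⋆·d⋆ − 1 = (a·b − d·c)·(c⋆·d⋆)`. -/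
theorem plaq_sub_one_eq_mul (a b : Matrix o o ℂ) {c d : Matrix o o ℂ} (hc : c ∈ Matrix.unitaryGroup o ℂ) (hd : d ∈ Matrix.unitaryGroup o ℂ) :
    a * b * star c * star d - 1 = (a * b - d * c) * (star c * star d) := by
  have hcc : c * star c = 1 := Matrix.mem_unitaryGroup_iff.1 hc
  have hdd : d * star d = 1 := Matrix.mem_unitaryGroup_iff.1 hd
  have h1 : d * c * (star c * star d) = 1 := by
    calc d * c * (star c * star d) = d * (c * star c) * star d := by noncomm_ring
      _ = 1 := by rw [hcc, mul_one, hdd]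
  calc a * b * star c * star d - 1 = a * b * (star c * star d) - d * c * (star c * star d) := by rw [h1]; noncomm_ring
    _ = (a * b - d * c) * (star c * star d) := by noncomm_ring

/-- [folklore] **CURL + QUADRATIC**: `a·b − d·c = (a − c) + (b − d) + (a − 1)(b − 1) − (d − 1)(c − 1)`. -/
theorem ab_sub_dc_eq (a b c d : Matrix o o ℂ) : a * b - d * c = (a - c) + (b - d) + (a - 1) * (b - 1) - (d - 1) * (c - 1) := by
  noncomm_ring

/-- [folklore] variation of a product of two deviations: `‖(a′−1)(b′−1) − (a−1)(b−1)‖ ≤ ‖a′ − a‖·‖b′ − 1‖ + ‖a − 1‖·‖b′ − b‖`. -/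
theorem norm_prodSubOne_sub_le (a b a' b' : Matrix o o ℂ) :
    ‖(a' - 1) * (b' - 1) - (a - 1) * (b - 1)‖ ≤ ‖a' - a‖ * ‖b' - 1‖ + ‖a - 1‖ * ‖b' - b‖ := by
  have e : (a' - 1) * (b' - 1) - (a - 1) * (b - 1) = (a' - a) * (b' - 1) + (a - 1) * (b' - b) := by noncomm_ring
  rw [e]
  exact (norm_add_le _ _).trans (add_le_add (norm_mul_le _ _) (norm_mul_le _ _))

/-- [folklore] a unitary matrix has norm `≤ 1` (also for empty `o`). -/
theorem norm_le_one_of_unitary {u : Matrix o o ℂ} (hu : u ∈ Matrix.unitaryGroup o ℂ) : ‖u‖ ≤ 1 := by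
  rcases isEmpty_or_nonempty o with ho | ho
  · have : u = 0 := Subsingleton.elim _ _
    rw [this, norm_zero]; exact zero_le_one
  · exact (CStarRing.norm_of_mem_unitary hu).le

/-- [folklore] variation of `c⋆·d⋆` for unitaries: `‖c′⋆d′⋆ − c⋆d⋆‖ ≤ ‖c′ − c‖ + ‖d′ − d‖`. -/
theorem norm_star_mul_star_sub_le {c d c' d' : Matrix o o ℂ} (hc' : c' ∈ Matrix.unitaryGroup o ℂ) (hd : d ∈ Matrix.unitaryGroup o ℂ) :
    ‖star c' * star d' - star c * star d‖ ≤ ‖c' - c‖ + ‖d' - d‖ := by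
  have e : star c' * star d' - star c * star d = star c' * (star d' - star d) + (star c' - star c) * star d := by noncomm_ring
  rw [e]
  calc ‖star c' * (star d' - star d) + (star c' - star c) * star d‖
      ≤ ‖star c'‖ * ‖star d' - star d‖ + ‖star c' - star c‖ * ‖star d‖ :=
        (norm_add_le _ _).trans (add_le_add (norm_mul_le _ _) (norm_mul_le _ _))
    _ ≤ 1 * ‖star d' - star d‖ + ‖star c' - star c‖ * 1 := by
        gcongr
        · rw [norm_star]; exact norm_le_one_of_unitary hc'
        · rw [norm_star]; exact norm_le_one_of_unitary hd
    _ = ‖c' - c‖ + ‖d' - d‖ := by rw [← star_sub, ← star_sub, norm_star, norm_star, one_mul, mul_one, add_comm]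

/-- [folklore] **VARIATION OF A PLAQUETTE** (generic): with `X = ab − dc`, `X′ = a′b′ − d′c′` and `c, d, c′, d′` unitary,
`‖a′b′c′⋆d′⋆ − abc⋆d⋆‖ ≤ ‖X′ − X‖ + ‖X‖·(‖c′ − c‖ + ‖d′ − d‖)`. -/
theorem norm_plaq_sub_plaq_le (a b a' b' : Matrix o o ℂ) {c d c' d' : Matrix o o ℂ} (hc : c ∈ Matrix.unitaryGroup o ℂ)
    (hd : d ∈ Matrix.unitaryGroup o ℂ) (hc' : c' ∈ Matrix.unitaryGroup o ℂ) (hd' : d' ∈ Matrix.unitaryGroup o ℂ) :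
    ‖a' * b' * star c' * star d' - a * b * star c * star d‖
      ≤ ‖(a' * b' - d' * c') - (a * b - d * c)‖ + ‖a * b - d * c‖ * (‖c' - c‖ + ‖d' - d‖) := by
  have e : a' * b' * star c' * star d' - a * b * star c * star d
      = (a' * b' * star c' * star d' - 1) - (a * b * star c * star d - 1) := by abel
  rw [e, plaq_sub_one_eq_mul a' b' hc' hd', plaq_sub_one_eq_mul a b hc hd]
  have e2 : (a' * b' - d' * c') * (star c' * star d') - (a * b - d * c) * (star c * star d)
      = ((a' * b' - d' * c') - (a * b - d * c)) * (star c' * star d') + (a * b - d * c) * (star c' * star d' - star c * star d) := by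
    noncomm_ring
  rw [e2]
  have hu : star c' * star d' ∈ Matrix.unitaryGroup o ℂ := mul_mem (Unitary.star_mem hc') (Unitary.star_mem hd')
  calc ‖((a' * b' - d' * c') - (a * b - d * c)) * (star c' * star d') + (a * b - d * c) * (star c' * star d' - star c * star d)‖
      ≤ ‖((a' * b' - d' * c') - (a * b - d * c)) * (star c' * star d')‖ + ‖(a * b - d * c) * (star c' * star d' - star c * star d)‖ :=
        norm_add_le _ _
    _ ≤ ‖(a' * b' - d' * c') - (a * b - d * c)‖ + ‖a * b - d * c‖ * ‖star c' * star d' - star c * star d‖ := by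
        rw [norm_mul_unitary _ hu]; exact add_le_add le_rfl (norm_mul_le _ _)
    _ ≤ ‖(a' * b' - d' * c') - (a * b - d * c)‖ + ‖a * b - d * c‖ * (‖c' - c‖ + ‖d' - d‖) := by
        gcongr; exact norm_star_mul_star_sub_le hc' hd

/-! ## §2 In the tower currency: the plaquette of a unitary (α, β, β₂)-regular level is Lipschitz at scale `ℓ⁻³` -/

section Tower

open Literature.MathematicalPhysics.QuantumFieldTheory.Balaban1983to89.B5Prop11Plancherel (fine Tor unitVec)
open Literature.MathematicalPhysics.QuantumFieldTheory.Balaban1983to89.B5G183RateUnitTower (lev lev_neZero)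
open Summit.QuantumFields.BalabanUV.T4Continuum.BalabanAveragedTowerUnit (idx one_le_lev')
open Summit.QuantumFields.BalabanUV.T4Continuum.BlockPairingGeometry (tau)
open Summit.QuantumFields.BalabanUV.T4Continuum.RegularBackgroundTower (RegularTransporters)

variable {d : ℕ} (L : ℕ) [NeZero L] (M : Fin d → ℕ) [hM : ∀ μ, NeZero (M μ)]
variable {R : (k : ℕ) → Fin d → (idx L M k → Matrix o o ℂ)} {α β β₂ : ℝ}

omit [Fintype o] [DecidableEq o] [NeZero L] hM in
/-- [folklore] lattice translations commute: `τ_ν (τ_ρ i) = τ_ρ (τ_ν i)`. -/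
theorem tau_tau_comm (k : ℕ) (ν ρ : Fin d) (i : idx L M k) :
    tau (fine (lev L k) M) ν (tau (fine (lev L k) M) ρ i) = tau (fine (lev L k) M) ρ (tau (fine (lev L k) M) ν i) := by
  simp only [BlockPairingGeometry.tau, add_right_comm]

omit hM in
/-- [folklore] the DISPLAYED second-difference letter, unscaled: `‖R(τ_ν τ_ρ i) − R(τ_ν i) − R(τ_ρ i) + R(i)‖ ≤ β₂∕(lev L k)³`. -/
theorem norm_second_diff_le_of_letter
    (h2 : ∀ k μ ν ρ (i : idx L M k), ‖((lev L k : ℕ) : ℂ) • (R k μ (tau (fine (lev L k) M) ν (tau (fine (lev L k) M) ρ i))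
        - R k μ (tau (fine (lev L k) M) ν i) - R k μ (tau (fine (lev L k) M) ρ i) + R k μ i)‖ ≤ β₂ / ((lev L k : ℕ) : ℝ) ^ 2)
    (k : ℕ) (μ ν ρ : Fin d) (i : idx L M k) :
    ‖R k μ (tau (fine (lev L k) M) ν (tau (fine (lev L k) M) ρ i)) - R k μ (tau (fine (lev L k) M) ν i) - R k μ (tau (fine (lev L k) M) ρ i)
        + R k μ i‖ ≤ β₂ / ((lev L k : ℕ) : ℝ) ^ 3 := by
  have hℓ : (0 : ℝ) < (lev L k : ℕ) := by exact_mod_cast one_le_lev' L k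
  have h1 := h2 k μ ν ρ i
  rw [norm_smul, Complex.norm_natCast] at h1
  rw [pow_succ, ← div_div, le_div_iff₀ hℓ, mul_comm]; exact h1

omit hM in
/-- [folklore] **THE PLAQUETTE OF A UNITARY (α, β, β₂)-REGULAR LEVEL IS LIPSCHITZ AT SCALE `ℓ⁻³`**: with `plaq(i) = R_μ(i)·R_ν(i+e_μ)·R_μ(i+e_ν)⋆·R_ν(i)⋆`,
`‖plaq(i + e_ρ) − plaq(i)‖ ≤ (2β₂ + 4αβ)∕(lev L k)³ + 2β·(2β + 2α²)∕(lev L k)⁴` — from the (3.35)-shape letters (α, β) of `RegularTransporters`, unitarity,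
and the DISPLAYED (3.36)-shape second-difference letter `h2` (β₂).  The curl terms `(a − c) + (b − d)` carry the second differences, the quadratic terms
`(a−1)(b−1) − (d−1)(c−1)` the products size × Lipschitz; the first-order letters alone give only `O(β∕(lev L k)²)` (owner R60 (3)). -/
theorem norm_plaquette_tau_sub_le_of_reg2 (h : RegularTransporters L M R α β)
    (hU : ∀ k μ (i : idx L M k), R k μ i ∈ Matrix.unitaryGroup o ℂ)
    (h2 : ∀ k μ ν ρ (i : idx L M k), ‖((lev L k : ℕ) : ℂ) • (R k μ (tau (fine (lev L k) M) ν (tau (fine (lev L k) M) ρ i))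
        - R k μ (tau (fine (lev L k) M) ν i) - R k μ (tau (fine (lev L k) M) ρ i) + R k μ i)‖ ≤ β₂ / ((lev L k : ℕ) : ℝ) ^ 2)
    (k : ℕ) (μ ν ρ : Fin d) (i : idx L M k) :
    ‖R k μ (tau (fine (lev L k) M) ρ i) * R k ν (tau (fine (lev L k) M) μ (tau (fine (lev L k) M) ρ i))
        * star (R k μ (tau (fine (lev L k) M) ν (tau (fine (lev L k) M) ρ i))) * star (R k ν (tau (fine (lev L k) M) ρ i))
      - R k μ i * R k ν (tau (fine (lev L k) M) μ i) * star (R k μ (tau (fine (lev L k) M) ν i)) * star (R k ν i)‖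
      ≤ (2 * β₂ + 4 * α * β) / ((lev L k : ℕ) : ℝ) ^ 3 + 2 * β * (2 * β + 2 * α ^ 2) / ((lev L k : ℕ) : ℝ) ^ 4 := by
  -- names
  set T := tau (fine (lev L k) M) with hT
  set a := R k μ i
  set b := R k ν (T μ i)
  set c := R k μ (T ν i)
  set e := R k ν i
  set a' := R k μ (T ρ i)
  set b' := R k ν (T μ (T ρ i))
  set c' := R k μ (T ν (T ρ i))
  set e' := R k ν (T ρ i)
  have hℓ1 : (1 : ℝ) ≤ (lev L k : ℕ) := by exact_mod_cast one_le_lev' L k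
  have hℓ : (0 : ℝ) < (lev L k : ℕ) := by linarith
  have hα : 0 ≤ α := h.nonneg.1
  have hβ : 0 ≤ β := h.nonneg.2
  -- the letters at the eight corners
  have ha1 : ‖a - 1‖ ≤ α / (lev L k : ℕ) := norm_sub_one_le_of_reg L M h k μ i
  have hb'1 : ‖b' - 1‖ ≤ α / (lev L k : ℕ) := norm_sub_one_le_of_reg L M h k ν _
  have hb1 : ‖b - 1‖ ≤ α / (lev L k : ℕ) := norm_sub_one_le_of_reg L M h k ν _
  have he1 : ‖e - 1‖ ≤ α / (lev L k : ℕ) := norm_sub_one_le_of_reg L M h k ν i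
  have hc'1 : ‖c' - 1‖ ≤ α / (lev L k : ℕ) := norm_sub_one_le_of_reg L M h k μ _
  have hc1 : ‖c - 1‖ ≤ α / (lev L k : ℕ) := norm_sub_one_le_of_reg L M h k μ _
  have haa : ‖a' - a‖ ≤ β / ((lev L k : ℕ) : ℝ) ^ 2 := norm_tau_sub_le_of_reg L M h k μ ρ i
  have hbb : ‖b' - b‖ ≤ β / ((lev L k : ℕ) : ℝ) ^ 2 := by
    show ‖R k ν (T μ (T ρ i)) - R k ν (T μ i)‖ ≤ _
    rw [hT, tau_tau_comm L M k μ ρ i]; exact norm_tau_sub_le_of_reg L M h k ν ρ _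
  have hcc : ‖c' - c‖ ≤ β / ((lev L k : ℕ) : ℝ) ^ 2 := by
    show ‖R k μ (T ν (T ρ i)) - R k μ (T ν i)‖ ≤ _
    rw [hT, tau_tau_comm L M k ν ρ i]; exact norm_tau_sub_le_of_reg L M h k μ ρ _
  have hee : ‖e' - e‖ ≤ β / ((lev L k : ℕ) : ℝ) ^ 2 := norm_tau_sub_le_of_reg L M h k ν ρ i
  -- the two second differences (curl terms)
  have hA : ‖(a' - c') - (a - c)‖ ≤ β₂ / ((lev L k : ℕ) : ℝ) ^ 3 := by
    have h1 := norm_second_diff_le_of_letter L M h2 k μ ν ρ i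
    have e1 : (a' - c') - (a - c) = -(R k μ (T ν (T ρ i)) - R k μ (T ν i) - R k μ (T ρ i) + R k μ i) := by
      show (R k μ (T ρ i) - R k μ (T ν (T ρ i))) - (R k μ i - R k μ (T ν i)) = _; abel
    rw [e1, norm_neg]; exact h1
  have hB : ‖(b' - e') - (b - e)‖ ≤ β₂ / ((lev L k : ℕ) : ℝ) ^ 3 := by
    have h1 := norm_second_diff_le_of_letter L M h2 k ν μ ρ i
    have e1 : (b' - e') - (b - e) = R k ν (T μ (T ρ i)) - R k ν (T μ i) - R k ν (T ρ i) + R k ν i := by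
      show (R k ν (T μ (T ρ i)) - R k ν (T ρ i)) - (R k ν (T μ i) - R k ν i) = _; abel
    rw [e1]; exact h1
  -- X and X′ − X
  have hX : ‖a * b - e * c‖ ≤ (2 * β + 2 * α ^ 2) / ((lev L k : ℕ) : ℝ) ^ 2 := by
    rw [ab_sub_dc_eq]
    have hac : ‖a - c‖ ≤ β / ((lev L k : ℕ) : ℝ) ^ 2 := by rw [norm_sub_rev]; exact norm_tau_sub_le_of_reg L M h k μ ν i
    have hbe : ‖b - e‖ ≤ β / ((lev L k : ℕ) : ℝ) ^ 2 := norm_tau_sub_le_of_reg L M h k ν μ i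
    calc ‖a - c + (b - e) + (a - 1) * (b - 1) - (e - 1) * (c - 1)‖
        ≤ ‖a - c‖ + ‖b - e‖ + ‖a - 1‖ * ‖b - 1‖ + ‖e - 1‖ * ‖c - 1‖ := by
          refine (norm_sub_le _ _).trans (add_le_add ((norm_add₃_le).trans (add_le_add le_rfl (norm_mul_le _ _))) (norm_mul_le _ _))
      _ ≤ β / ((lev L k : ℕ) : ℝ) ^ 2 + β / ((lev L k : ℕ) : ℝ) ^ 2 + α / (lev L k : ℕ) * (α / (lev L k : ℕ)) + α / (lev L k : ℕ) * (α / (lev L k : ℕ)) := by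
          gcongr
      _ = (2 * β + 2 * α ^ 2) / ((lev L k : ℕ) : ℝ) ^ 2 := by field_simp; ring
  have hXX : ‖(a' * b' - e' * c') - (a * b - e * c)‖ ≤ (2 * β₂ + 4 * α * β) / ((lev L k : ℕ) : ℝ) ^ 3 := by
    have e1 : (a' * b' - e' * c') - (a * b - e * c)
        = ((a' - c') - (a - c)) + ((b' - e') - (b - e)) + (((a' - 1) * (b' - 1) - (a - 1) * (b - 1)) - ((e' - 1) * (c' - 1) - (e - 1) * (c - 1))) := by
      rw [ab_sub_dc_eq, ab_sub_dc_eq]; abel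
    rw [e1]
    calc ‖(a' - c') - (a - c) + ((b' - e') - (b - e)) + (((a' - 1) * (b' - 1) - (a - 1) * (b - 1)) - ((e' - 1) * (c' - 1) - (e - 1) * (c - 1)))‖
        ≤ ‖(a' - c') - (a - c)‖ + ‖(b' - e') - (b - e)‖ + (‖(a' - 1) * (b' - 1) - (a - 1) * (b - 1)‖ + ‖(e' - 1) * (c' - 1) - (e - 1) * (c - 1)‖) :=
          (norm_add₃_le).trans (add_le_add le_rfl (norm_sub_le _ _))
      _ ≤ β₂ / ((lev L k : ℕ) : ℝ) ^ 3 + β₂ / ((lev L k : ℕ) : ℝ) ^ 3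
          + ((β / ((lev L k : ℕ) : ℝ) ^ 2 * (α / (lev L k : ℕ)) + α / (lev L k : ℕ) * (β / ((lev L k : ℕ) : ℝ) ^ 2))
            + (β / ((lev L k : ℕ) : ℝ) ^ 2 * (α / (lev L k : ℕ)) + α / (lev L k : ℕ) * (β / ((lev L k : ℕ) : ℝ) ^ 2))) := by
          gcongr
          · exact (norm_prodSubOne_sub_le a b a' b').trans (by gcongr)
          · exact (norm_prodSubOne_sub_le e c e' c').trans (by gcongr)
      _ = (2 * β₂ + 4 * α * β) / ((lev L k : ℕ) : ℝ) ^ 3 := by field_simp; ring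
  -- assemble
  have hmain := norm_plaq_sub_plaq_le a b a' b' (hU k μ (T ν i)) (hU k ν i) (hU k μ (T ν (T ρ i))) (hU k ν (T ρ i))
  refine hmain.trans ?_
  have hX0 : 0 ≤ ‖a * b - e * c‖ := norm_nonneg _
  calc ‖(a' * b' - e' * c') - (a * b - e * c)‖ + ‖a * b - e * c‖ * (‖c' - c‖ + ‖e' - e‖)
      ≤ (2 * β₂ + 4 * α * β) / ((lev L k : ℕ) : ℝ) ^ 3 + (2 * β + 2 * α ^ 2) / ((lev L k : ℕ) : ℝ) ^ 2 * (β / ((lev L k : ℕ) : ℝ) ^ 2 + β / ((lev L k : ℕ) : ℝ) ^ 2) := by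
        gcongr
    _ = (2 * β₂ + 4 * α * β) / ((lev L k : ℕ) : ℝ) ^ 3 + 2 * β * (2 * β + 2 * α ^ 2) / ((lev L k : ℕ) : ℝ) ^ 4 := by
        field_simp; ring

end Tower

end Summit.QuantumFields.BalabanUV.T4Continuum.B13AvgCorrPlaquetteSecond

end
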